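import Summits.RiemannHypothesis.RiemannHypothesis.Theorems.PfPersistenceM2EvenInterpolation
import Summits.RiemannHypothesis.RiemannHypothesis.Theorems.PfPersistenceM2EvenSectorIndexBound
import Summits.RiemannHypothesis.RiemannHypothesis.Theorems.RuelleBandExactFirstBandStubEvenSymTranslate
import HarnessLib

/-!
# PF-persistence, M2 seat (gen 5), part 2/3: the negative index of the even real Weil form on long windows is
# AT LEAST the number `K` of off-line quadruples (the "≥" half of Bombieri's count), when `K < ∞`

pub-rhpf cell, M2 seat, generation 5.  HONEST FRAMING (page 1 of everything in this cell): a long-odds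
MECHANISM SEARCH around Weil's quadratic functional; NOTHING here claims, approaches or conditionally proves RH.
Labels: PROVED = kernel-checked; CITED = in print (Bombieri 2000, Rend. Lincei (9) 11, Thms 9–11);
HYPOTHESIS = an explicit binder.

Write `Q(g) = weilQuadratic g` (the untruncated Weil form `W(g ⋆ g̃)`), `ĝ = weilMellin g`,
`𝒬 = {ρ : ζ(ρ) = 0 non-trivial, Re ρ > 1/2, Im ρ > 0}` (quadrant representatives of off-line quadruples), `K = #𝒬`.

PROVED (`exists_negative_definite_even_family_of_finite`, RH-free): if `𝒬` is FINITE (HYPOTHESIS `hfin`) then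
for every `n ≤ K` there are a window `A` and `n` even real-valued Weil tests supported in `[-A, A]` on whose
real span `Re Q` is NEGATIVE DEFINITE.  With gen 4 (`card_le_encard_quadrant_of_negative_family`: such a family
forces `n ≤ K`, no finiteness needed) the negative index of the even real Weil form on long windows is EXACTLY
`K` (part 3, `exists_evenNegIndexAtLeast_iff`).  CITED shape: Bombieri 2000 Thm 9 (even part) — there for
finite truncations `Γ_N` / a fixed window; here for the untruncated form, window-uniform, kernel-checked.

Mechanism: interpolate `φ̂ᵢ(ρⱼ) = i·δᵢⱼ` on `𝒬` (part 1; `i² = -1` makes the tuned zero-side term NEGATIVE);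
translate symmetrically, `gᵢ = (φᵢ(· - Tᵢ) + φᵢ(· + Tᵢ))/2` with `Tᵢ ∈ (2π/γᵢ)ℕ` TUNED to
`ρᵢ = 1/2 + δᵢ + iγᵢ`, so that `ĝᵢ(ρᵢ) = i·cosh(δᵢTᵢ)` exactly (`coshFactor_eq_of_tuned`), while
`|ĝᵢ| ≤ |φ̂ᵢ|` on the critical line (`norm_coshFactor_le_one`) and `Re ĝᵢ = 0` at EVERY off-line zero
(annihilation on `𝒬` + symmetry transport, `re_weilMellin_eq_zero_of_quadrant`).  For `G = Σ cᵢ gᵢ`,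
`Re Q(G) = Σ_ρ m(ρ)((Re Ĝ)² - (Im Ĝ)²)(ρ)` (explicit formula `explicit_formula_holds`, `P_G = Ĝ²`); with
`Λ = Σᵢ Σ_ρ m(ρ)‖P_{φᵢ}(ρ)‖` and `cosh(δᵢTᵢ) ≥ Λ + 1`: `Re Q(G) ≤ (Σcᵢ²)Λ - (Σcᵢ²)(Λ + 1) < 0`.
What this does NOT touch: `K = ∞` (finitely many compactly supported probes cannot dominate the tail; in print
Bombieri 2000, Cor. to Thm 11) and any lower bound on the first even level (that is Weil positivity = RH-strength).

Reused by name: part 1 (`exists_evenRealTest_weilMellin_eq`), gen 4 `PfPersistenceM2EvenSectorIndexBound`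
(`weilMellin_conj`), `RuelleBandExactFirstBandStubEvenSymTranslate` (`isWeilTest_symTranslate`, `symTranslate_even`,
`symTranslate_im`, `weilMellin_symTranslate`), `…StubEvenTransfer` (`stub_evenTransfer_conj_weilMellin`,
`stub_evenTransfer_pairCoeff`), `…StubEvenExpSum` (`weilMellin_one_sub_of_even`), Literature `WeilCriterionConverse`
(`pairCoeff`, `zeroForm`, `summable_norm_pairCoeff`, `hasWeilZeroSide_zeroForm`), `explicit_formula_holds`.
-/

noncomputable section

set_option linter.dupNamespace false

open Complex Filter Set MeasureTheory
open scoped Real Topology ComplexConjugate BigOperators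

namespace Summit.RiemannHypothesis.RiemannHypothesis.Theorems.PfPersistenceM2NegIndex

open Literature.NumberTheory.LFunctions
open Literature.NumberTheory.LFunctions.WeilConverse
open Literature.NumberTheory.LFunctions.ZetaZeros
open Summit.RiemannHypothesis.RiemannHypothesis.Theorems.RuelleBandExactFirstBand
  (stub_evenTransfer_conj_weilMellin stub_evenTransfer_pairCoeff weilMellin_one_sub_of_even
    isWeilTest_symTranslate symTranslate_even symTranslate_im weilMellin_symTranslate)

/-! ## C. Negative-definite even families on long windows, under finitely many off-line zeros -/

/-- Re-part symmetry transport (companion of `im_weilMellin_eq_zero_of_quadrant`): for an even real `g`, if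
`Re ĝ` vanishes on a set `Z` containing every non-trivial zero of the open quadrant `Re ρ > 1/2, Im ρ > 0`, then
`Re ĝ(ρ) = 0` at every OFF-LINE non-trivial zero `ρ` (`ĝ` takes the values `x, x̄, x, x̄` on the quadruple
`ρ, ρ̄, 1-ρ, 1-ρ̄`). [cite: Bombieri2000Weil, Thm 9] -/
theorem re_weilMellin_eq_zero_of_quadrant {g : ℝ → ℂ} (heven : ∀ t : ℝ, g (-t) = g t)
    (hreal : ∀ t : ℝ, (g t).im = 0) {Z : Set ℂ}
    (hZ : ∀ ρ ∈ riemannZetaNontrivialZeros, 1 / 2 < ρ.re → 0 < ρ.im → ρ ∈ Z)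
    (hvan : ∀ ρ ∈ Z, (weilMellin g ρ).re = 0) {ρ : ℂ} (hρ : ρ ∈ riemannZetaNontrivialZeros)
    (hoff : ρ.re ≠ 1 / 2) : (weilMellin g ρ).re = 0 := by
  have him : ρ.im ≠ 0 := riemannZetaNontrivialZeros.im_ne_zero hρ
  rcases lt_or_gt_of_ne hoff with hlt | hgt
  · rcases lt_or_gt_of_ne him with hneg | hpos
    · have hmem : 1 - ρ ∈ riemannZetaNontrivialZeros := by
        simpa using riemannZetaNontrivialZeros.one_sub_conj_mem (riemannZetaNontrivialZeros.conj_mem hρ)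
      have h1 := hvan _ (hZ _ hmem (by simp only [Complex.sub_re, Complex.one_re]; linarith)
        (by simp only [Complex.sub_im, Complex.one_im]; linarith))
      rwa [weilMellin_one_sub_of_even heven] at h1
    · have hmem := riemannZetaNontrivialZeros.one_sub_conj_mem hρ
      have h1 := hvan _ (hZ _ hmem (by simp only [Complex.sub_re, Complex.one_re, Complex.conj_re]; linarith)
        (by simp only [Complex.sub_im, Complex.one_im, Complex.conj_im]; linarith))
      rwa [← stub_evenTransfer_conj_weilMellin heven hreal, Complex.conj_re] at h1
  · rcases lt_or_gt_of_ne him with hneg | hpos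
    · have hmem := riemannZetaNontrivialZeros.conj_mem hρ
      have h1 := hvan _ (hZ _ hmem (by simp only [Complex.conj_re]; linarith)
        (by simp only [Complex.conj_im]; linarith))
      rwa [weilMellin_conj heven hreal, Complex.conj_re] at h1
    · exact hvan _ (hZ _ hρ hgt hpos)

/-- The symmetric translate by `T ≥ 0` of a function supported in `[-b, b]` is supported in `[-(b+T), b+T]`.
[folklore] -/
theorem tsupport_symTranslate_subset {φ : ℝ → ℂ} {b T : ℝ} (hφ : tsupport φ ⊆ Icc (-b) b) (hT : 0 ≤ T) :
    tsupport (fun t : ℝ ↦ (φ (t - T) + φ (t + T)) / 2) ⊆ Icc (-(b + T)) (b + T) := by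
  refine closure_minimal (fun t ht ↦ ?_) isClosed_Icc
  rw [Function.mem_support] at ht
  by_contra hout
  apply ht
  have h0 : ∀ x : ℝ, x ∉ Icc (-b) b → φ x = 0 := fun x hx ↦
    image_eq_zero_of_notMem_tsupport fun hx' ↦ hx (hφ hx')
  have h1 : φ (t - T) = 0 := h0 _ fun hmem ↦ hout (by
    rw [mem_Icc] at hmem ⊢
    constructor <;> linarith [hmem.1, hmem.2])
  have h2 : φ (t + T) = 0 := h0 _ fun hmem ↦ hout (by
    rw [mem_Icc] at hmem ⊢
    constructor <;> linarith [hmem.1, hmem.2])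
  rw [h1, h2, add_zero, zero_div]

/-- On the critical line the transform factor of a symmetric translate has modulus `≤ 1` (`|cos γT| ≤ 1`).
[folklore] -/
theorem norm_coshFactor_le_one {s : ℂ} (hs : s.re = 1 / 2) (T : ℝ) :
    ‖(cexp ((s - 1 / 2) * T) + cexp (-((s - 1 / 2) * T))) / 2‖ ≤ 1 := by
  have hre : ((s - 1 / 2) * (T : ℂ)).re = 0 := by
    simp [Complex.mul_re, hs]
  have h1 : ‖cexp ((s - 1 / 2) * T)‖ = 1 := by rw [Complex.norm_exp, hre, Real.exp_zero]
  have h2 : ‖cexp (-((s - 1 / 2) * T))‖ = 1 := by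
    rw [Complex.norm_exp, Complex.neg_re, hre, neg_zero, Real.exp_zero]
  rw [norm_div, RCLike.norm_two]
  have h3 := norm_add_le (cexp ((s - 1 / 2) * T)) (cexp (-((s - 1 / 2) * T)))
  rw [h1, h2] at h3
  linarith

/-- Tuned translation: if `Im s · T ∈ 2πℕ` then the transform factor of the symmetric translate by `T` is the
REAL number `cosh((Re s - 1/2) T) = (e^{(Re s - 1/2)T} + e^{-(Re s - 1/2)T})/2`. [folklore] -/
theorem coshFactor_eq_of_tuned {s : ℂ} {T : ℝ} {k : ℕ} (hk : s.im * T = 2 * π * k) :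
    (cexp ((s - 1 / 2) * T) + cexp (-((s - 1 / 2) * T))) / 2 =
      (((Real.exp ((s.re - 1 / 2) * T) + Real.exp (-((s.re - 1 / 2) * T))) / 2 : ℝ) : ℂ) := by
  have hw : (s - 1 / 2) * (T : ℂ) = (((s.re - 1 / 2) * T : ℝ) : ℂ) + (k : ℂ) * (2 * π * I) := by
    apply Complex.ext
    · simp [Complex.mul_re, Complex.mul_im]
    · simp [Complex.mul_re, Complex.mul_im, hk]
      ring
  have he : cexp ((s - 1 / 2) * T) = ((Real.exp ((s.re - 1 / 2) * T) : ℝ) : ℂ) := by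
    rw [hw, Complex.exp_add, Complex.exp_nat_mul_two_pi_mul_I, mul_one, Complex.ofReal_exp]
  have he' : cexp (-((s - 1 / 2) * T)) = ((Real.exp (-((s.re - 1 / 2) * T)) : ℝ) : ℂ) := by
    rw [Complex.exp_neg, he, Real.exp_neg, Complex.ofReal_inv]
  rw [he, he', Complex.ofReal_div, Complex.ofReal_add, Complex.ofReal_ofNat]

/-- **MAIN (the "≥" half of Bombieri's count, window-uniform, for the untruncated Weil form).**  Suppose `ζ` has
only FINITELY many zeros `ρ₁, …, ρ_K` in the open quadrant `Re ρ > 1/2, Im ρ > 0` (i.e. `K` off-line quadruples).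
Then for every `n ≤ K` there are a window `A` and `n` even, real-valued Weil test functions `g₁, …, g_n` supported
in `[-A, A]` on whose real span `Re Q` is NEGATIVE DEFINITE: `Re Q(Σ cᵢ gᵢ) < 0` for every real `c ≠ 0`.
With the "≤" half (`card_le_encard_quadrant_of_negative_family`, gen 4) the negative index of the even real Weil
form on long windows is EXACTLY `K`.

Construction: by interpolation (`exists_evenRealTest_weilMellin_eq`) pick even real unit tests `φᵢ` with
`φ̂ᵢ(ρⱼ) = i δᵢⱼ` on the quadrant set; put `gᵢ = (φᵢ(· - Tᵢ) + φᵢ(· + Tᵢ))/2` with `Tᵢ ∈ (2π/γᵢ)ℕ` TUNED so that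
`ĝᵢ(ρᵢ) = i κᵢ`, `κᵢ = cosh(δᵢ Tᵢ) ≥ Λ + 1`, where `Λ = Σᵢ Σ_ρ m(ρ)‖P_{φᵢ}(ρ)‖` is the total zero-side mass of the
`φᵢ`.  For `G = Σ cᵢ gᵢ`: `Re Q(G) = Σ_ρ m(ρ)((Re Ĝ)² - (Im Ĝ)²)(ρ)` (explicit formula, `P_G = Ĝ²`); the positive
part is `≤ (Σ cᵢ²) Λ` because `Re ĝᵢ` VANISHES at every off-line zero (exact annihilation on the quadrant set +
symmetry transport) and `|ĝᵢ| ≤ |φ̂ᵢ|` on the line (Cauchy–Schwarz in `i`); the negative part is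
`≥ Σᵢ cᵢ² κᵢ² ≥ (Σ cᵢ²)(Λ + 1)` from the `n` tuned zeros alone.  [cite: Bombieri2000Weil, Thm 9 (even part); Thm 11] -/
theorem exists_negative_definite_even_family_of_finite
    (hfin : {ρ : ℂ | ρ ∈ riemannZetaNontrivialZeros ∧ 1 / 2 < ρ.re ∧ 0 < ρ.im}.Finite) {n : ℕ}
    (hn : n ≤ hfin.toFinset.card) :
    ∃ A : ℝ, ∃ g : Fin n → ℝ → ℂ, (∀ i, IsWeilTest (g i)) ∧ (∀ i (t : ℝ), g i (-t) = g i t) ∧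
      (∀ i (t : ℝ), (g i t).im = 0) ∧ (∀ i, tsupport (g i) ⊆ Icc (-A) A) ∧
      ∀ c : Fin n → ℝ, c ≠ 0 → (weilQuadratic (fun t : ℝ ↦ ∑ i, (c i : ℂ) * g i t)).re < 0 := by
  classical
  set Z : Finset ℂ := hfin.toFinset with hZdef
  have hZmem : ∀ ρ : ℂ, ρ ∈ Z ↔ ρ ∈ riemannZetaNontrivialZeros ∧ 1 / 2 < ρ.re ∧ 0 < ρ.im :=
    fun ρ ↦ hfin.mem_toFinset
  have hZq : ∀ ρ ∈ Z, 1 / 2 < ρ.re ∧ 0 < ρ.im := fun ρ hρ ↦ ((hZmem ρ).1 hρ).2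
  have hZall : ∀ ρ ∈ riemannZetaNontrivialZeros, 1 / 2 < ρ.re → 0 < ρ.im → ρ ∈ (Z : Set ℂ) :=
    fun ρ hρ h1 h2 ↦ Finset.mem_coe.2 ((hZmem ρ).2 ⟨hρ, h1, h2⟩)
  -- `n` distinct quadrant zeros `e i`
  let e : Fin n → ℂ := fun i ↦ (Z.equivFin.symm (Fin.castLE hn i) : ℂ)
  have he_mem : ∀ i, e i ∈ Z := fun i ↦ (Z.equivFin.symm (Fin.castLE hn i)).2
  have he_inj : Function.Injective e := fun i j h ↦
    Fin.castLE_injective hn (Z.equivFin.symm.injective (Subtype.ext h))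
  have he_ntz : ∀ i, e i ∈ riemannZetaNontrivialZeros := fun i ↦ ((hZmem _).1 (he_mem i)).1
  have hδ : ∀ i, 0 < (e i).re - 1 / 2 := fun i ↦ by linarith [(hZq _ (he_mem i)).1]
  have hγ : ∀ i, 0 < (e i).im := fun i ↦ (hZq _ (he_mem i)).2
  -- Step 1: interpolating unit tests `φ i` with `φ̂ᵢ = i·[ρ = e i]` on `Z`
  have hφ : ∀ i : Fin n, ∃ φ : ℝ → ℂ, IsWeilTest φ ∧ (∀ t : ℝ, φ (-t) = φ t) ∧
      (∀ t : ℝ, (φ t).im = 0) ∧ tsupport φ ⊆ Icc (-1) 1 ∧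
      ∀ ρ ∈ Z, weilMellin φ ρ = if ρ = e i then I else 0 := fun i ↦
    exists_evenRealTest_weilMellin_eq Z hZq fun ρ ↦ if ρ = e i then I else 0
  choose φ hφt hφe hφr hφs hφv using hφ
  -- Step 2: the total zero-side mass `Λ` of the `φ i`
  set Λ : ℝ := ∑ i, ∑' ρ : riemannZetaNontrivialZeros,
      ‖(riemannZetaZeroOrder (ρ : ℂ) : ℂ) * pairCoeff (φ i) ρ‖ with hΛdef
  have hΛ0 : 0 ≤ Λ := Finset.sum_nonneg fun i _ ↦ tsum_nonneg fun ρ ↦ norm_nonneg _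
  -- Step 3: tuned translation lengths `T i ∈ (2π/γᵢ)ℕ` with `δᵢ Tᵢ ≥ 2Λ + 1`
  have hT : ∀ i, ∃ T : ℝ, 0 ≤ T ∧ (∃ k : ℕ, (e i).im * T = 2 * π * k) ∧
      2 * Λ + 1 ≤ ((e i).re - 1 / 2) * T := by
    intro i
    obtain ⟨k, hk⟩ := exists_nat_ge ((2 * Λ + 1) * (e i).im / (2 * π * ((e i).re - 1 / 2)))
    refine ⟨2 * π * k / (e i).im, div_nonneg (by positivity) (hγ i).le, ⟨k, ?_⟩, ?_⟩
    · rw [mul_div_assoc', mul_div_cancel_left₀ _ (hγ i).ne']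
    · have h1 : (2 * Λ + 1) * (e i).im ≤ k * (2 * π * ((e i).re - 1 / 2)) :=
        (div_le_iff₀ (mul_pos (mul_pos two_pos Real.pi_pos) (hδ i))).1 hk
      rw [mul_div_assoc', le_div_iff₀ (hγ i)]
      linarith [h1]
  choose T hT0 hTk hTδ using hT
  -- Step 4: the family: symmetric translates `g i` of the `φ i` by `T i`; window `A = 1 + Σ T i`
  set g : Fin n → ℝ → ℂ := fun i t ↦ (φ i (t - T i) + φ i (t + T i)) / 2 with hgdef
  have hgt : ∀ i, IsWeilTest (g i) := fun i ↦ isWeilTest_symTranslate (hφt i) (T i)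
  have hge : ∀ i (t : ℝ), g i (-t) = g i t := fun i t ↦ symTranslate_even (hφe i) (T i) t
  have hgr : ∀ i (t : ℝ), (g i t).im = 0 := fun i t ↦ symTranslate_im (hφr i) (T i) t
  have hgm : ∀ i (s : ℂ), weilMellin (g i) s =
      weilMellin (φ i) s * ((cexp ((s - 1 / 2) * T i) + cexp (-((s - 1 / 2) * T i))) / 2) :=
    fun i s ↦ weilMellin_symTranslate (hφt i) (T i) s
  refine ⟨1 + ∑ i, T i, g, hgt, hge, hgr, fun i ↦ ?_, fun c hc ↦ ?_⟩
  · have hTi : T i ≤ ∑ j, T j := Finset.single_le_sum (f := T) (fun j _ ↦ hT0 j) (Finset.mem_univ i)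
    refine (tsupport_symTranslate_subset (hφs i) (hT0 i)).trans (Icc_subset_Icc ?_ ?_) <;> linarith
  -- Step 5: the combination `G = Σ cᵢ gᵢ` is an even real Weil test with `Ĝ = Σ cᵢ ĝᵢ`
  have hGtest : IsWeilTest (fun t : ℝ ↦ ∑ i, (c i : ℂ) * g i t) :=
    isWeilTest_finset_sum Finset.univ fun i _ ↦ (hgt i).const_mul (c i)
  have hGeven : ∀ t : ℝ, (fun t : ℝ ↦ ∑ i, (c i : ℂ) * g i t) (-t) =
      (fun t : ℝ ↦ ∑ i, (c i : ℂ) * g i t) t := fun t ↦ by simp only [hge]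
  have hGreal : ∀ t : ℝ, ((fun t : ℝ ↦ ∑ i, (c i : ℂ) * g i t) t).im = 0 := fun t ↦ by
    simp [Complex.im_sum, Complex.mul_im, hgr]
  have hGmellin : ∀ s : ℂ, weilMellin (fun t : ℝ ↦ ∑ i, (c i : ℂ) * g i t) s =
      ∑ i, (c i : ℂ) * weilMellin (g i) s := fun s ↦ by
    have h := weilMellin_finset_sum Finset.univ (f := fun i (t : ℝ) ↦ (c i : ℂ) * g i t)
      (fun i _ ↦ (hgt i).const_mul (c i)) s
    simpa only [weilMellin_const_mul] using h
  set G : ℝ → ℂ := fun t : ℝ ↦ ∑ i, (c i : ℂ) * g i t with hGdef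
  -- Step 6: `Re Q(G) = Σ m X² - Σ m Y²` with `X = Re Ĝ`, `Y = Im Ĝ` on the non-trivial zeros
  have hQ : zeroForm G = weilQuadratic G :=
    tendsto_nhds_unique (hasWeilZeroSide_zeroForm hGtest)
      (explicit_formula_holds (hGtest.weilConv hGtest.weilReflect))
  have hm0 : ∀ ρ : riemannZetaNontrivialZeros, (0 : ℝ) ≤ (riemannZetaZeroOrder (ρ : ℂ) : ℝ) := fun ρ ↦ by
    have h0 : (0 : ℤ) ≤ riemannZetaZeroOrder (ρ : ℂ) :=
      le_trans zero_le_one (riemannZetaNontrivialZeros.one_le_order ρ.2)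
    exact_mod_cast h0
  have hm1 : ∀ ρ : riemannZetaNontrivialZeros, (1 : ℝ) ≤ (riemannZetaZeroOrder (ρ : ℂ) : ℝ) := fun ρ ↦ by
    exact_mod_cast riemannZetaNontrivialZeros.one_le_order ρ.2
  set X : riemannZetaNontrivialZeros → ℝ := fun ρ ↦ (weilMellin G ρ).re with hXdef
  set Y : riemannZetaNontrivialZeros → ℝ := fun ρ ↦ (weilMellin G ρ).im with hYdef
  have hterm : ∀ ρ : riemannZetaNontrivialZeros, ((riemannZetaZeroOrder (ρ : ℂ) : ℂ) * pairCoeff G ρ).re =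
      (riemannZetaZeroOrder (ρ : ℂ) : ℝ) * X ρ ^ 2 - (riemannZetaZeroOrder (ρ : ℂ) : ℝ) * Y ρ ^ 2 :=
    fun ρ ↦ by
      rw [stub_evenTransfer_pairCoeff hGeven hGreal]
      simp only [Complex.mul_re, Complex.mul_im, Complex.intCast_re, Complex.intCast_im, hXdef, hYdef]
      ring
  have hnorm : ∀ ρ : riemannZetaNontrivialZeros, ‖(riemannZetaZeroOrder (ρ : ℂ) : ℂ) * pairCoeff G ρ‖ =
      (riemannZetaZeroOrder (ρ : ℂ) : ℝ) * (X ρ ^ 2 + Y ρ ^ 2) := fun ρ ↦ by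
    rw [norm_mul, Complex.norm_intCast, stub_evenTransfer_pairCoeff hGeven hGreal, norm_mul, ← sq,
      Complex.sq_norm, Complex.normSq_apply, abs_of_nonneg (hm0 ρ)]
    simp only [hXdef, hYdef]
    ring
  have hsumN := summable_norm_pairCoeff hGtest
  have hsumX : Summable fun ρ : riemannZetaNontrivialZeros ↦ (riemannZetaZeroOrder (ρ : ℂ) : ℝ) * X ρ ^ 2 :=
    Summable.of_nonneg_of_le (fun ρ ↦ mul_nonneg (hm0 ρ) (sq_nonneg _))
      (fun ρ ↦ by rw [hnorm]; nlinarith [hm0 ρ, sq_nonneg (Y ρ)]) hsumN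
  have hsumY : Summable fun ρ : riemannZetaNontrivialZeros ↦ (riemannZetaZeroOrder (ρ : ℂ) : ℝ) * Y ρ ^ 2 :=
    Summable.of_nonneg_of_le (fun ρ ↦ mul_nonneg (hm0 ρ) (sq_nonneg _))
      (fun ρ ↦ by rw [hnorm]; nlinarith [hm0 ρ, sq_nonneg (X ρ)]) hsumN
  have hre : (weilQuadratic G).re =
      ∑' ρ : riemannZetaNontrivialZeros, (riemannZetaZeroOrder (ρ : ℂ) : ℝ) * X ρ ^ 2 -
        ∑' ρ : riemannZetaNontrivialZeros, (riemannZetaZeroOrder (ρ : ℂ) : ℝ) * Y ρ ^ 2 := by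
    rw [← hQ, zeroForm, Complex.re_tsum (summable_pairCoeff hGtest), ← hsumX.tsum_sub hsumY]
    exact tsum_congr hterm
  -- Step 7: the positive part is at most `S Λ`, `S = Σ cᵢ²`
  set S : ℝ := ∑ i, c i ^ 2 with hSdef
  have hSpos : 0 < S := by
    obtain ⟨i, hi⟩ : ∃ i, c i ≠ 0 := Function.ne_iff.1 hc
    have h1 : c i ^ 2 ≤ S :=
      Finset.single_le_sum (f := fun j ↦ c j ^ 2) (fun j _ ↦ sq_nonneg (c j)) (Finset.mem_univ i)
    have h2 : 0 < c i ^ 2 := lt_of_le_of_ne (sq_nonneg _) (Ne.symm (pow_ne_zero 2 hi))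
    linarith
  set P : riemannZetaNontrivialZeros → ℝ := fun ρ ↦
    ∑ i, ‖(riemannZetaZeroOrder (ρ : ℂ) : ℂ) * pairCoeff (φ i) ρ‖ with hPdef
  have hsumP : Summable P := summable_sum fun i _ ↦ summable_norm_pairCoeff (hφt i)
  have hPtsum : ∑' ρ, P ρ = Λ := Summable.tsum_finsetSum fun i _ ↦ summable_norm_pairCoeff (hφt i)
  -- per-zero domination `(Re ĝᵢ(ρ))² ≤ ‖φ̂ᵢ(ρ)‖²`: on the line `|factor| ≤ 1`; off the line `Re ĝᵢ(ρ) = 0`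
  have hReg : ∀ i, ∀ ρ ∈ riemannZetaNontrivialZeros,
      (weilMellin (g i) ρ).re ^ 2 ≤ ‖weilMellin (φ i) ρ‖ ^ 2 := by
    intro i ρ hρ
    by_cases hline : ρ.re = 1 / 2
    · calc (weilMellin (g i) ρ).re ^ 2 ≤ ‖weilMellin (g i) ρ‖ ^ 2 := by
            rw [Complex.sq_norm, Complex.normSq_apply]
            nlinarith [sq_nonneg (weilMellin (g i) ρ).im]
        _ ≤ ‖weilMellin (φ i) ρ‖ ^ 2 := by
          rw [hgm, norm_mul]
          exact pow_le_pow_left₀ (by positivity)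
            (mul_le_of_le_one_right (norm_nonneg _) (norm_coshFactor_le_one hline (T i))) 2
    · have hvan : ∀ ρ' ∈ (Z : Set ℂ), (weilMellin (g i) ρ').re = 0 := by
        intro ρ' hρ'
        rw [hgm, hφv i ρ' (Finset.mem_coe.1 hρ')]
        split_ifs with h
        · obtain ⟨k, hk⟩ := hTk i
          rw [h, coshFactor_eq_of_tuned hk]
          simp only [Complex.mul_re, Complex.I_re, Complex.I_im, Complex.ofReal_re, Complex.ofReal_im,
            zero_mul, mul_zero, sub_self]
        · simp
      rw [re_weilMellin_eq_zero_of_quadrant (hge i) (hgr i) hZall hvan hρ hline, sq, mul_zero]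
      positivity
  have hXb : ∀ ρ : riemannZetaNontrivialZeros, (riemannZetaZeroOrder (ρ : ℂ) : ℝ) * X ρ ^ 2 ≤ S * P ρ := by
    intro ρ
    have hXeq : X ρ = ∑ i, c i * (weilMellin (g i) ρ).re := by
      simp only [hXdef, hGmellin, Complex.re_sum, Complex.re_ofReal_mul]
    have h1 : X ρ ^ 2 ≤ S * ∑ i, (weilMellin (g i) ρ).re ^ 2 := by
      rw [hXeq]
      exact Finset.sum_mul_sq_le_sq_mul_sq Finset.univ c fun i ↦ (weilMellin (g i) ρ).re
    have h2 : ∑ i, (weilMellin (g i) ρ).re ^ 2 ≤ ∑ i, ‖weilMellin (φ i) ρ‖ ^ 2 :=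
      Finset.sum_le_sum fun i _ ↦ hReg i ρ ρ.2
    have h3 : (riemannZetaZeroOrder (ρ : ℂ) : ℝ) * ∑ i, ‖weilMellin (φ i) (ρ : ℂ)‖ ^ 2 = P ρ := by
      simp only [hPdef, Finset.mul_sum]
      refine Finset.sum_congr rfl fun i _ ↦ ?_
      rw [norm_mul, Complex.norm_intCast, stub_evenTransfer_pairCoeff (hφe i) (hφr i), norm_mul, ← sq,
        abs_of_nonneg (hm0 ρ)]
    calc (riemannZetaZeroOrder (ρ : ℂ) : ℝ) * X ρ ^ 2
        ≤ (riemannZetaZeroOrder (ρ : ℂ) : ℝ) * (S * ∑ i, (weilMellin (g i) ρ).re ^ 2) :=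
          mul_le_mul_of_nonneg_left h1 (hm0 ρ)
      _ ≤ (riemannZetaZeroOrder (ρ : ℂ) : ℝ) * (S * ∑ i, ‖weilMellin (φ i) ρ‖ ^ 2) :=
          mul_le_mul_of_nonneg_left (mul_le_mul_of_nonneg_left h2 hSpos.le) (hm0 ρ)
      _ = S * P ρ := by rw [← h3]; ring
  have hXsum : ∑' ρ : riemannZetaNontrivialZeros, (riemannZetaZeroOrder (ρ : ℂ) : ℝ) * X ρ ^ 2 ≤ S * Λ := by
    calc ∑' ρ : riemannZetaNontrivialZeros, (riemannZetaZeroOrder (ρ : ℂ) : ℝ) * X ρ ^ 2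
        ≤ ∑' ρ, S * P ρ := hsumX.tsum_le_tsum hXb (hsumP.mul_left S)
      _ = S * Λ := by rw [tsum_mul_left, hPtsum]
  -- Step 8: the negative part is at least `S (Λ + 1)`, from the `n` tuned zeros `e i` alone
  set κ : Fin n → ℝ := fun i ↦
    (Real.exp (((e i).re - 1 / 2) * T i) + Real.exp (-(((e i).re - 1 / 2) * T i))) / 2 with hκdef
  have hκ1 : ∀ i, Λ + 1 ≤ κ i := fun i ↦ by
    have h1 : ((e i).re - 1 / 2) * T i + 1 ≤ Real.exp (((e i).re - 1 / 2) * T i) :=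
      Real.add_one_le_exp _
    have h2 : 0 < Real.exp (-(((e i).re - 1 / 2) * T i)) := Real.exp_pos _
    have h3 := hTδ i
    simp only [hκdef]
    linarith
  have hGei : ∀ i, weilMellin G (e i) = (c i : ℂ) * (I * (κ i : ℂ)) := fun i ↦ by
    rw [hGmellin, Finset.sum_eq_single i]
    · obtain ⟨k, hk⟩ := hTk i
      rw [hgm, hφv i (e i) (he_mem i), if_pos rfl, coshFactor_eq_of_tuned hk]
    · intro j _ hji
      rw [hgm, hφv j (e i) (he_mem i), if_neg (fun h ↦ hji (he_inj h).symm)]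
      simp
    · intro h
      exact absurd (Finset.mem_univ i) h
  let ez : Fin n → riemannZetaNontrivialZeros := fun i ↦ ⟨e i, he_ntz i⟩
  have hez_inj : Function.Injective ez := fun i j h ↦ he_inj (congrArg Subtype.val h :)
  have hYi : ∀ i, Y (ez i) = c i * κ i := fun i ↦ by
    simp only [hYdef]
    show (weilMellin G (e i)).im = c i * κ i
    rw [hGei]
    simp [Complex.mul_im, Complex.mul_re]
  have hYsum : S * (Λ + 1) ≤
      ∑' ρ : riemannZetaNontrivialZeros, (riemannZetaZeroOrder (ρ : ℂ) : ℝ) * Y ρ ^ 2 := by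
    have h1 : ∑ ρ ∈ Finset.univ.image ez, (riemannZetaZeroOrder (ρ : ℂ) : ℝ) * Y ρ ^ 2 ≤
        ∑' ρ : riemannZetaNontrivialZeros, (riemannZetaZeroOrder (ρ : ℂ) : ℝ) * Y ρ ^ 2 :=
      hsumY.sum_le_tsum _ fun ρ _ ↦ mul_nonneg (hm0 ρ) (sq_nonneg _)
    rw [Finset.sum_image fun i _ j _ h ↦ hez_inj h] at h1
    refine le_trans ?_ h1
    rw [hSdef, Finset.sum_mul]
    refine Finset.sum_le_sum fun i _ ↦ ?_
    rw [hYi]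
    have hκ := hκ1 i
    have hm := hm1 (ez i)
    have hc2 : 0 ≤ c i ^ 2 := sq_nonneg _
    have hΛ1 : 0 ≤ Λ + 1 := by linarith
    calc c i ^ 2 * (Λ + 1) ≤ c i ^ 2 * (Λ + 1) ^ 2 := by
          apply mul_le_mul_of_nonneg_left _ hc2
          nlinarith [mul_nonneg hΛ0 hΛ1]
      _ ≤ c i ^ 2 * κ i ^ 2 := by
          apply mul_le_mul_of_nonneg_left _ hc2
          exact pow_le_pow_left₀ hΛ1 hκ 2
      _ = 1 * (c i * κ i) ^ 2 := by ring
      _ ≤ (riemannZetaZeroOrder ((ez i : riemannZetaNontrivialZeros) : ℂ) : ℝ) * (c i * κ i) ^ 2 :=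
          mul_le_mul_of_nonneg_right hm (sq_nonneg _)
  -- Step 9: conclusion `Re Q(G) ≤ S Λ - S (Λ + 1) = -S < 0`
  rw [hre]
  linarith [hXsum, hYsum, hSpos]

end Summit.RiemannHypothesis.RiemannHypothesis.Theorems.PfPersistenceM2NegIndex

end
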